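import Literature.RepresentationTheory.BorelWallach2000.UpqMaximalCompactBlocks
import Literature.LinearAlgebra.Matrix.UnitaryGroupExpSurjective
import Literature.LinearAlgebra.Matrix.CompactClassicalGroupsExpSurjective
import HarnessLib

/-!
# Every element of the maximal compact subgroup `K = U(α) × U(β)` of `U(α, β)` is an exponential: `K = exp 𝔨`

Topic `RepresentationTheory/BorelWallach2000`; namespace `Literature.RepresentationTheory.BorelWallach2000` (sequel of ★
`UpqMaximalCompactBlocks`: `k = diag(k₁₁, k₂₂)` with `k₁₁ = upqKBlock₁ k ∈ U(α)`, `k₂₂ = upqKBlock₂ k ∈ U(β)`).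
Theorems only: no definition, no instance, no notation, no named fact, no `sorry`.  Generic `U(α, β)`.

Knapp, *Lie Groups Beyond an Introduction*, I §1 Example (3) and VI §2: `K = U(p) × U(q)` is the maximal compact subgroup of
`U(p, q)`, with Lie algebra `𝔨 = 𝔲(p) ⊕ 𝔲(q)` embedded block-diagonally [cite: Knapp2002, I §1 Example (3)]; Bröcker–tom Dieck
IV (2.2): the exponential map of a compact connected Lie group is surjective, for `U(n)` via the maximal torus (★
`Literature.LinearAlgebra.Matrix.exists_mem_skewAdjoint_exp_eq`) [cite: BrockerTomDieck1985, IV (2.2) (p0155)].  Combining the two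
blockwise (★ `exp_fromBlocks_zero`: `exp (X₁ ⊕ X₂) = exp X₁ ⊕ exp X₂`):

* `upq_fromBlocks_mem_compactLie` — `diag(X₁, X₂) ∈ 𝔨 = 𝔲(α,β) ∩ 𝔲(α ⊕ β)` for skew-Hermitian `X₁`, `X₂`;
* `coe_expK_fromBlocks` — `expK diag(X₁, X₂) = diag(exp X₁, exp X₂)` as matrices;
* **`upq_exists_expK_eq`** — every `k ∈ K` is `expK X` for some `X ∈ 𝔨`; `upq_expK_surjective`, `upq_range_expK`,
  **`upq_closure_range_expK_eq_top`** — `Subgroup.closure (range expK) = ⊤`, the hypothesis `hK` of the `(𝔤, K)`-module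
  constructor `IsGKModule.of_hasWeakDeriv` (`Ad`-compatibility automatic on `⟨exp 𝔨⟩`).

This is the `U(α, β)` analogue of ★ `U11Classify.exists_expK_kDiag_eq` (`U(1,1)`, where `K` is a torus).

## Mathlib / Literature search

★ `exists_mem_skewAdjoint_exp_eq` (`LinearAlgebra/Matrix/UnitaryGroupExpSurjective`), ★ `exp_fromBlocks_zero`
(`LinearAlgebra/Matrix/CompactClassicalGroupsExpSurjective`), ★ `upq_fromBlocks_mem_lie_iff` (`TrivialModuleGKCohomologyUnitary`),
★ `coe_eq_fromBlocks_upqKBlock` (`UpqMaximalCompactBlocks`), `RealMatrixGroup.mem_compactLie_iff` / `coe_expK` / `coe_expGL`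
(`NumberTheory/Automorphic/RealMatrixGroups`); Mathlib `Matrix.fromBlocks_conjTranspose`, `Matrix.fromBlocks_neg`,
`skewAdjoint.mem_iff`.  Dedup: `rg "exists_expK|expK_surj|closure.*expK"` — only the `U(1,1)` torus lemma.

## References

* A. W. Knapp, *Lie Groups Beyond an Introduction*, 2nd ed., Birkhäuser (2002), I §1 Example (3), VI §2. [Knapp2002]
* Th. Bröcker, T. tom Dieck, *Representations of Compact Lie Groups*, GTM 98, Springer (1985), IV (2.2). [BrockerTomDieck1985]
* A. Borel, N. Wallach (2000), 0 §2.5 (the `(𝔤, K)`-module axioms this serves). [BorelWallach2000]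
-/

noncomputable section

open scoped MatrixGroups Matrix

namespace Literature.RepresentationTheory.BorelWallach2000

open Literature.NumberTheory.Automorphic
open Literature.RepresentationTheory.KonnoKonno2007 Literature.RepresentationTheory.KonnoKonno2007.RealDualPair
open Literature.RepresentationTheory.KonnoKonno2007.RealDualPair.UForm

variable {α β : Type*} [Fintype α] [DecidableEq α] [Fintype β] [DecidableEq β]

/-- **`𝔨` in blocks**: for skew-Hermitian `X₁ ∈ 𝔲(α)`, `X₂ ∈ 𝔲(β)`, the block-diagonal matrix `diag(X₁, X₂)` lies in
`𝔨 = 𝔲(α, β) ∩ 𝔲(α ⊕ β)`. [cite: Knapp2002, I §1 Example (3)] -/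
theorem upq_fromBlocks_mem_compactLie {X₁ : Matrix α α ℂ} {X₂ : Matrix β β ℂ} (h₁ : X₁ᴴ = -X₁) (h₂ : X₂ᴴ = -X₂) :
    Matrix.fromBlocks X₁ 0 0 X₂ ∈ (uFormGroup α β).compactLie := by
  rw [RealMatrixGroup.mem_compactLie_iff]
  refine ⟨(upq_fromBlocks_mem_lie_iff X₁ 0 0 X₂).mpr ⟨h₁, h₂, ?_⟩, ?_⟩
  · rw [Matrix.conjTranspose_zero]
  · rw [Matrix.star_eq_conjTranspose, Matrix.fromBlocks_conjTranspose, h₁, h₂, Matrix.conjTranspose_zero,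
      Matrix.conjTranspose_zero, Matrix.fromBlocks_neg]
    simp only [neg_zero]

/-- **`exp diag(X₁, X₂) = diag(exp X₁, exp X₂)`** in `K`, as matrices (★ `exp_fromBlocks_zero`).
[cite: BrockerTomDieck1985, I (3.2), (3.3) (p0025)] -/
theorem coe_expK_fromBlocks {X₁ : Matrix α α ℂ} {X₂ : Matrix β β ℂ} (h₁ : X₁ᴴ = -X₁) (h₂ : X₂ᴴ = -X₂) :
    ((((uFormGroup α β).expK ⟨Matrix.fromBlocks X₁ 0 0 X₂, upq_fromBlocks_mem_compactLie h₁ h₂⟩ :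
        (uFormGroup α β).maximalCompact) : GL (α ⊕ β) ℂ) : Matrix (α ⊕ β) (α ⊕ β) ℂ) =
      Matrix.fromBlocks (NormedSpace.exp X₁) 0 0 (NormedSpace.exp X₂) := by
  rw [RealMatrixGroup.coe_expK, coe_expGL]
  exact Literature.LinearAlgebra.Matrix.exp_fromBlocks_zero X₁ X₂

/-- **`K = exp 𝔨` for `U(α, β)`: every `k ∈ K = U(α) × U(β)` is `expK X` for a block-diagonal skew-Hermitian `X ∈ 𝔨`** —
`k₁₁ = exp X₁`, `k₂₂ = exp X₂` by Bröcker–tom Dieck IV (2.2) for `U(α)`, `U(β)` (★ `exists_mem_skewAdjoint_exp_eq`), and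
`k = diag(k₁₁, k₂₂) = exp diag(X₁, X₂)`. [cite: BrockerTomDieck1985, IV (2.2) (p0155)] [cite: Knapp2002, I §1 Example (3)] -/
theorem upq_exists_expK_eq (k : (uFormGroup α β).maximalCompact) :
    ∃ X : (uFormGroup α β).compactLie, (uFormGroup α β).expK X = k := by
  obtain ⟨X₁, hX₁, e₁⟩ := Literature.LinearAlgebra.Matrix.exists_mem_skewAdjoint_exp_eq (upqKBlock₁ k)
  obtain ⟨X₂, hX₂, e₂⟩ := Literature.LinearAlgebra.Matrix.exists_mem_skewAdjoint_exp_eq (upqKBlock₂ k)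
  have h₁ : X₁ᴴ = -X₁ := by rw [← Matrix.star_eq_conjTranspose]; exact skewAdjoint.mem_iff.mp hX₁
  have h₂ : X₂ᴴ = -X₂ := by rw [← Matrix.star_eq_conjTranspose]; exact skewAdjoint.mem_iff.mp hX₂
  refine ⟨⟨Matrix.fromBlocks X₁ 0 0 X₂, upq_fromBlocks_mem_compactLie h₁ h₂⟩, Subtype.ext (Units.ext ?_)⟩
  rw [coe_expK_fromBlocks h₁ h₂, e₁, e₂, coe_eq_fromBlocks_upqKBlock]

/-- The exponential `𝔨 → K` of `U(α, β)` is surjective. [cite: BrockerTomDieck1985, IV (2.2) (p0155)] -/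
theorem upq_expK_surjective : Function.Surjective (uFormGroup α β).expK :=
  upq_exists_expK_eq

/-- The exponential `𝔨 → K` of `U(α, β)` has range all of `K`. [cite: BrockerTomDieck1985, IV (2.2) (p0155)] -/
theorem upq_range_expK : Set.range (uFormGroup α β).expK = Set.univ :=
  Set.range_eq_univ.mpr upq_expK_surjective

/-- **`K = ⟨exp 𝔨⟩` for `U(α, β)`**: the subgroup of `K` generated by the exponentials is all of `K` — the hypothesis under
which `Ad`-compatibility of a `(𝔤, K)`-module is automatic (Borel–Wallach 0 §2.5 for connected `K`).
[cite: BrockerTomDieck1985, IV (2.2) (p0155)] [cite: BorelWallach2000, 0 §2.5] -/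
theorem upq_closure_range_expK_eq_top : Subgroup.closure (Set.range (uFormGroup α β).expK) = ⊤ := by
  rw [upq_range_expK, Subgroup.closure_univ]

end Literature.RepresentationTheory.BorelWallach2000
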